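import Summits.NavierStokesRegularity.NavierStokesRegularity.Theorems.AdaptedKernelExists.Negative.ComovingDisplacement
import Summits.NavierStokesRegularity.NavierStokesRegularity.Theorems.AdaptedKernelExists.Negative.GalileanCalibration

/-!
# `AdaptedKernelExists` (stmt-NavierStokesRegularity-2956): the dichotomy for uniform drifts and the log-sharpness of the rate

Negative / support lemmas for the crux `AdaptedFrequency.AdaptedKernelExists`, extracted from the
crux work file `Cruxes/AdaptedKernelExists/Disproof.lean` (cdisprove seats, cycle 2 §6.1–6.2;
resubmission of p78665, which bounced only because the gate restarted in flight). No conclusion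
asserts a route item.

* §6.1 DICHOTOMY for uniform drifts `u = a(t) e`: `isGaussianComparable_recentred_of_disp` —
  parabolic TOTAL displacement `D² ‖e‖² ≤ K² (T − t)` ⇒ the explicit recentred adapted kernel is
  two-sided Gaussian-comparable (constants `e^{−K²/(2ν)}(4πν)^{-3/2}`, `2ν`, `e^{K²/(4ν)}(4πν)^{-3/2}`,
  `8ν`); `uniform_no_comparable_of_unbounded_disp` — dyadic displacement²/(T − t) unbounded ⇒ NO
  adapted kernel of the drift is comparable (corollary of `comparable_displacement_bound`).  For
  monotone amplitudes: comparable ⟺ Type I — the rate is SHARP for the linear claim.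
* §6.2 WITNESS of the sharpness up to a logarithm: the uniform drift with displacement
  `logDisp T t = 2√(T − t)·log(e + 1/(T − t))` (amplitude `logAmp`, classical NS
  `isClassicalNSSolutionOn_logSuper`) misses Type I by a bare log (`sqrt_mul_logAmp`,
  `tendsto_sqrt_mul_logAmp`) and has NO comparable adapted kernel (`logSuper_no_comparable_adapted`,
  via `logDisp_dyadic_unbounded`).
-/

noncomputable section

namespace Summit.NavierStokesRegularity.NavierStokesRegularity.Theorems.AdaptedKernelExistsNegative.Comoving

open Set Filter Topology MeasureTheory Function
open scoped Laplacian InnerProductSpace RealInnerProductSpace ContDiff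
open Literature.Analysis.FluidPDE Literature.Analysis

local notation "ℝ³" => EuclideanSpace ℝ (Fin 3)

open UniformDrift SuperTypeI Galilean
open Metric

/-! ### §6.1 (Disproof) The dichotomy for uniform drifts: comparable ⟺ parabolic displacement

Positive half (generalising `gal_two_sided`): if the TOTAL displacement is parabolic,
`D(t)² ‖e‖² ≤ K² (T - t)` on the window, the explicit recentred kernel is comparable with
`c₁ = (4πν)^{-3/2}e^{-K²/(2ν)}`, `c₂ = 2ν`, `C₁ = (4πν)^{-3/2}e^{K²/(4ν)}`, `C₂ = 8ν`. Negative half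
(corollary of `comparable_displacement_bound`): if the DYADIC displacement is not parabolic,
`sup_t (D(t) - D((t+T)/2))² ‖e‖²/(T - t) = ∞`, then NO adapted kernel of the drift is comparable.
For an eventually non-decreasing amplitude `a ≥ 0` the dyadic displacement is `≥ a(t)(T - t)/2`, so
the negative half applies as soon as `√(T - t)·a(t)` is unbounded: for monotone uniform drifts the
linear claim holds EXACTLY in the Type-I class — the rate is sharp, not only load-bearing (a
`√log` loss in the rate already kills comparability). -/

section Dichotomy

variable {ν t₀ T : ℝ} {x₀ e : ℝ³} {a D : ℝ → ℝ}

/-- **Parabolic total displacement ⇒ the recentred kernel is comparable** (explicit constants;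
`gal_two_sided` is the case `D = 2C√(T - t)`, `K² = 4C²‖e‖²`). [folklore] -/
theorem recentred_two_sided_of_disp (hν : 0 < ν) {K t : ℝ} (ht : t < T)
    (hDt : (D t) ^ 2 * ‖e‖ ^ 2 ≤ K ^ 2 * (T - t)) (x : ℝ³) :
    (4 * Real.pi * ν) ^ (-(3 : ℝ) / 2) * Real.exp (-(K ^ 2 / (2 * ν))) *
          (T - t) ^ (-(3 : ℝ) / 2) * Real.exp (-(‖x - x₀‖ ^ 2) / (2 * ν * (T - t))) ≤
        recentredKernel ν T x₀ e D t x ∧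
      recentredKernel ν T x₀ e D t x ≤
        (4 * Real.pi * ν) ^ (-(3 : ℝ) / 2) * Real.exp (K ^ 2 / (4 * ν)) *
          (T - t) ^ (-(3 : ℝ) / 2) * Real.exp (-(‖x - x₀‖ ^ 2) / (8 * ν * (T - t))) := by
  have hs : 0 < T - t := sub_pos.2 ht
  set s := T - t with hsdef
  set A : ℝ := (4 * Real.pi * ν) ^ (-(3 : ℝ) / 2) with hA
  have hde : ‖D t • e‖ ^ 2 = (D t) ^ 2 * ‖e‖ ^ 2 := by
    rw [norm_smul, mul_pow, Real.norm_eq_abs, sq_abs]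
  rw [recentredKernel_closed_form hν.le x₀ e _ ht x]
  have hz : ‖x - x₀‖ ^ 2 ≤ 2 * ‖x - x₀ + D t • e‖ ^ 2 + 2 * ‖D t • e‖ ^ 2 := by
    have := norm_add_sq_le_two_mul (x - x₀ + D t • e) (-(D t • e))
    rwa [add_neg_cancel_right, norm_neg] at this
  have hw : ‖x - x₀ + D t • e‖ ^ 2 ≤ 2 * ‖x - x₀‖ ^ 2 + 2 * ‖D t • e‖ ^ 2 :=
    norm_add_sq_le_two_mul _ _
  rw [hde] at hz hw
  constructor
  · have hexp : -(K ^ 2 / (2 * ν)) + -(‖x - x₀‖ ^ 2) / (2 * ν * s) ≤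
        -(‖x - x₀ + D t • e‖ ^ 2) / (4 * ν * s) := by
      rw [← sub_nonneg]
      have hkey : -(‖x - x₀ + D t • e‖ ^ 2) / (4 * ν * s) -
          (-(K ^ 2 / (2 * ν)) + -(‖x - x₀‖ ^ 2) / (2 * ν * s)) =
          (2 * ‖x - x₀‖ ^ 2 + 2 * (K ^ 2 * s) - ‖x - x₀ + D t • e‖ ^ 2) / (4 * ν * s) := by
        field_simp
        ring
      rw [hkey]
      exact div_nonneg (by nlinarith [hw, hDt]) (by positivity)
    have := Real.exp_le_exp.2 hexp
    rw [Real.exp_add] at this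
    calc A * Real.exp (-(K ^ 2 / (2 * ν))) * s ^ (-(3 : ℝ) / 2) *
          Real.exp (-(‖x - x₀‖ ^ 2) / (2 * ν * s))
        = A * s ^ (-(3 : ℝ) / 2) * (Real.exp (-(K ^ 2 / (2 * ν))) *
          Real.exp (-(‖x - x₀‖ ^ 2) / (2 * ν * s))) := by ring
      _ ≤ A * s ^ (-(3 : ℝ) / 2) * Real.exp (-(‖x - x₀ + D t • e‖ ^ 2) / (4 * ν * s)) :=
          mul_le_mul_of_nonneg_left this (by positivity)
  · have hexp : -(‖x - x₀ + D t • e‖ ^ 2) / (4 * ν * s) ≤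
        K ^ 2 / (4 * ν) + -(‖x - x₀‖ ^ 2) / (8 * ν * s) := by
      rw [← sub_nonneg]
      have hkey : K ^ 2 / (4 * ν) + -(‖x - x₀‖ ^ 2) / (8 * ν * s) -
          -(‖x - x₀ + D t • e‖ ^ 2) / (4 * ν * s) =
          (2 * ‖x - x₀ + D t • e‖ ^ 2 + 2 * (K ^ 2 * s) - ‖x - x₀‖ ^ 2) / (8 * ν * s) := by
        field_simp
        ring
      rw [hkey]
      exact div_nonneg (by nlinarith [hz, hDt]) (by positivity)
    have := Real.exp_le_exp.2 hexp
    rw [Real.exp_add] at this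
    calc A * s ^ (-(3 : ℝ) / 2) * Real.exp (-(‖x - x₀ + D t • e‖ ^ 2) / (4 * ν * s))
        ≤ A * s ^ (-(3 : ℝ) / 2) * (Real.exp (K ^ 2 / (4 * ν)) *
          Real.exp (-(‖x - x₀‖ ^ 2) / (8 * ν * s))) := mul_le_mul_of_nonneg_left this (by positivity)
      _ = A * Real.exp (K ^ 2 / (4 * ν)) * s ^ (-(3 : ℝ) / 2) *
          Real.exp (-(‖x - x₀‖ ^ 2) / (8 * ν * s)) := by ring

/-- **Positive half of the dichotomy.** If the total displacement of the uniform drift is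
parabolic on the window, `D(t)²‖e‖² ≤ K²(T - t)` for `t ∈ [t₀, T)`, then its recentred kernel is
two-sided Gaussian-comparable there. [folklore] -/
theorem isGaussianComparable_recentred_of_disp (hν : 0 < ν) {K : ℝ}
    (hDK : ∀ t ∈ Ico t₀ T, (D t) ^ 2 * ‖e‖ ^ 2 ≤ K ^ 2 * (T - t)) :
    IsGaussianComparable (recentredKernel ν T x₀ e D) (Ico t₀ T) T x₀ := by
  rw [isGaussianComparable_iff_fin_three]
  refine ⟨(4 * Real.pi * ν) ^ (-(3 : ℝ) / 2) * Real.exp (-(K ^ 2 / (2 * ν))), 2 * ν,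
    (4 * Real.pi * ν) ^ (-(3 : ℝ) / 2) * Real.exp (K ^ 2 / (4 * ν)), 8 * ν,
    by positivity, by positivity, by positivity, by positivity, fun t ht x => ?_⟩
  have h := recentred_two_sided_of_disp (x₀ := x₀) hν ht.2 (hDK t ht) x
  rw [show 2 * ν * (T - t) = (2 * ν) * (T - t) by ring,
    show 8 * ν * (T - t) = (8 * ν) * (T - t) by ring] at h
  exact h

/-- **Negative half of the dichotomy.** If the dyadic displacement of the uniform drift `a(t) e`
is NOT parabolic — `(D(t) - D((t+T)/2))² ‖e‖² / (T - t)` is unbounded on `(t₀, T)` for a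
displacement with `D' = -a` — then NO adapted kernel of the drift on `[t₀, T)` (at any pole `x₀`)
is two-sided Gaussian-comparable. [folklore] -/
theorem uniform_no_comparable_of_unbounded_disp (hν : 0 < ν) (x₀ : ℝ³)
    (hD : ∀ t ∈ Ioo t₀ T, HasDerivAt D (-a t) t)
    (hunb : ∀ M : ℝ, ∃ t ∈ Ioo t₀ T, M ≤ (D t - D ((t + T) / 2)) ^ 2 * ‖e‖ ^ 2 / (T - t)) :
    ¬ ∃ G : ℝ → ℝ³ → ℝ, IsAdaptedBackwardKernel ν (uniformVel a e) (Ico t₀ T) T x₀ G ∧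
        IsGaussianComparable G (Ico t₀ T) T x₀ := by
  rintro ⟨G, hK, hG⟩
  obtain ⟨c₁, c₂, C₁, C₂, hc₁, hc₂, hC₁, hC₂, hb⟩ := isGaussianComparable_iff_fin_three.1 hG
  have hm := dispConst_pos hν hc₁ c₂
  -- the admissible size of the exponent
  set M₀ : ℝ := C₂ * Real.log (C₁ / dispConst ν c₁ c₂) with hM₀
  obtain ⟨t, ht, hMt⟩ := hunb (M₀ + C₂)
  have hs : 0 < T - t := sub_pos.2 ht.2
  have hbound := comparable_displacement_bound hν Ioo_subset_Ico_self hK hD hc₁ hc₂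
    (fun t ht x => (hb t (Ioo_subset_Ico_self ht) x).1)
    (fun t ht x => (hb t (Ioo_subset_Ico_self ht) x).2) ht
  set X : ℝ := (D t - D ((t + T) / 2)) ^ 2 * ‖e‖ ^ 2 with hX
  -- `exp(X/(C₂ s)) ≤ C₁/m₀`, hence `X/s ≤ M₀`
  have h1 : Real.exp (X / (C₂ * (T - t))) ≤ C₁ / dispConst ν c₁ c₂ := by
    rw [le_div_iff₀ hm, mul_comm]
    exact hbound
  have h2 : X / (C₂ * (T - t)) ≤ Real.log (C₁ / dispConst ν c₁ c₂) := by
    have := Real.log_le_log (Real.exp_pos _) h1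
    rwa [Real.log_exp] at this
  have h3 : X / (T - t) ≤ M₀ := by
    rw [hM₀]
    have h4 : X / (T - t) = C₂ * (X / (C₂ * (T - t))) := by
      field_simp
    rw [h4]
    exact mul_le_mul_of_nonneg_left h2 hC₂.le
  have h5 : M₀ + C₂ ≤ X / (T - t) := by rw [hX]; exact hMt
  linarith

end Dichotomy

/-! ### §6.2 (Disproof) The rate is sharp up to a logarithm: a log-super-Type-I uniform drift with NO comparable kernel

Witness for the last sentence of §6.1: the uniform drift with displacement
`D(t) = 2√(T - t) · log(e + 1/(T - t))` has amplitude `a = -D'` with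
`√(T - t)·a(t) = log(e + 1/(T - t)) - 2/(e(T - t) + 1) → ∞` — it misses the Type-I class by a bare
LOGARITHM — yet its dyadic displacement is `≳ √(T - t)·log(1/(T - t))`, not parabolic, so by §6.1
NO adapted kernel of it is Gaussian-comparable. The linear transfer target `C⁺` cannot be extended
to any "Type I up to a slowly divergent factor" class. -/

section LogSuper

variable {ν T : ℝ} {x₀ e : ℝ³}

/-- `L(s) = log(e + 1/s)`, the slowly divergent factor. -/
def slowLog (s : ℝ) : ℝ := Real.log (Real.exp 1 + s⁻¹)

/-- Log-super displacement `D(t) = 2√(T - t) · log(e + 1/(T - t))`. -/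
def logDisp (T : ℝ) (t : ℝ) : ℝ := 2 * Real.sqrt (T - t) * slowLog (T - t)

/-- Its amplitude `a = -D'`: `a(t) = log(e + 1/s)/√s - 2/(√s (e s + 1))`, `s = T - t`. -/
def logAmp (T : ℝ) (t : ℝ) : ℝ :=
  slowLog (T - t) / Real.sqrt (T - t) - 2 / (Real.sqrt (T - t) * (Real.exp 1 * (T - t) + 1))

/-- `e + 1/s > 1` for `s > 0`. [folklore] -/
theorem one_lt_exp_add_inv {s : ℝ} (hs : 0 < s) : 1 < Real.exp 1 + s⁻¹ := by
  have h1 : 1 < Real.exp 1 := by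
    have := Real.add_one_lt_exp (one_ne_zero (α := ℝ))
    linarith
  have h2 : 0 < s⁻¹ := inv_pos.2 hs
  linarith

/-- `L(s) > 0` for `s > 0`. [folklore] -/
theorem slowLog_pos {s : ℝ} (hs : 0 < s) : 0 < slowLog s := Real.log_pos (one_lt_exp_add_inv hs)

/-- `L(s/2) ≤ L(s) + log 2` (`e + 2/s ≤ 2(e + 1/s)`). [folklore] -/
theorem slowLog_half_le {s : ℝ} (hs : 0 < s) : slowLog (s / 2) ≤ slowLog s + Real.log 2 := by
  unfold slowLog
  have h0 : 0 < Real.exp 1 + s⁻¹ := by linarith [one_lt_exp_add_inv hs]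
  rw [← Real.log_mul h0.ne' two_ne_zero]
  apply Real.log_le_log (by linarith [one_lt_exp_add_inv (half_pos hs)])
  rw [inv_div, div_eq_mul_inv]
  nlinarith [Real.exp_pos 1, inv_pos.2 hs]

/-- `L(s) → ∞` as `s ↓ 0`. [folklore] -/
theorem tendsto_slowLog : Tendsto slowLog (𝓝[>] 0) atTop := by
  unfold slowLog
  exact Real.tendsto_log_atTop.comp
    (tendsto_atTop_add_const_left _ _ tendsto_inv_nhdsGT_zero)

/-- **`D' = -a`** for the log-super member. [folklore] -/
theorem hasDerivAt_logDisp {T t : ℝ} (ht : t < T) : HasDerivAt (logDisp T) (-(logAmp T t)) t := by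
  have hs : 0 < T - t := sub_pos.2 ht
  have hsq : 0 < Real.sqrt (T - t) := Real.sqrt_pos.2 hs
  have hE : 0 < Real.exp 1 + (T - t)⁻¹ := by linarith [one_lt_exp_add_inv hs]
  have h1 : HasDerivAt (fun r : ℝ => T - r) (-1) t := (hasDerivAt_id' t).const_sub T
  have h2 : HasDerivAt (fun r : ℝ => Real.sqrt (T - r)) ((-1) / (2 * Real.sqrt (T - t))) t :=
    h1.sqrt hs.ne'
  have h3 : HasDerivAt (fun r : ℝ => Real.exp 1 + (T - r)⁻¹) (-(-1) / (T - t) ^ 2) t :=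
    (h1.inv hs.ne').const_add _
  have h4 : HasDerivAt (fun r : ℝ => slowLog (T - r)) ((-(-1) / (T - t) ^ 2) / (Real.exp 1 + (T - t)⁻¹)) t := by
    unfold slowLog
    exact h3.log hE.ne'
  have h5 : HasDerivAt (fun r : ℝ => 2 * Real.sqrt (T - r) * slowLog (T - r))
      (2 * ((-1) / (2 * Real.sqrt (T - t))) * slowLog (T - t) +
        2 * Real.sqrt (T - t) * ((-(-1) / (T - t) ^ 2) / (Real.exp 1 + (T - t)⁻¹))) t :=
    (h2.const_mul 2).mul h4
  show HasDerivAt (fun r : ℝ => 2 * Real.sqrt (T - r) * slowLog (T - r)) (-(logAmp T t)) t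
  refine h5.congr_deriv ?_
  unfold logAmp slowLog
  have key : ∀ r L E : ℝ, 0 < r → 0 < E →
      2 * ((-1) / (2 * r)) * L + 2 * r * ((-(-1) / (r ^ 2) ^ 2) / (E + (r ^ 2)⁻¹)) =
        -(L / r - 2 / (r * (E * r ^ 2 + 1))) := by
    intro r L E hr hE'
    have h6 : E + (r ^ 2)⁻¹ ≠ 0 := by positivity
    have h7 : E * r ^ 2 + 1 ≠ 0 := by positivity
    field_simp
    ring
  have hr : Real.sqrt (T - t) ^ 2 = T - t := Real.sq_sqrt hs.le
  have := key (Real.sqrt (T - t)) (Real.log (Real.exp 1 + (T - t)⁻¹)) (Real.exp 1) hsq (Real.exp_pos 1)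
  rw [hr] at this
  exact this

/-- **Exactly a logarithm beyond Type I.** `√(T - t)·a(t) = log(e + 1/(T - t)) - 2/(e(T - t) + 1)`;
in particular `√(T - t)·a(t) → ∞` (NOT Type-I) while `√(T - t)·a(t) ≤ log(e + 1/(T - t))`. [folklore] -/
theorem sqrt_mul_logAmp {T t : ℝ} (ht : t < T) :
    Real.sqrt (T - t) * logAmp T t = slowLog (T - t) - 2 / (Real.exp 1 * (T - t) + 1) := by
  have hs : 0 < T - t := sub_pos.2 ht
  have hsq : 0 < Real.sqrt (T - t) := Real.sqrt_pos.2 hs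
  have hpos : 0 < Real.exp 1 * (T - t) + 1 := by positivity
  unfold logAmp
  field_simp

/-- The log-super member is NOT Type-I: `√(T - t)·a(t) → ∞` as `t ↑ T`. [folklore] -/
theorem tendsto_sqrt_mul_logAmp (T : ℝ) :
    Tendsto (fun t => Real.sqrt (T - t) * logAmp T t) (𝓝[<] T) atTop := by
  have h1 : Tendsto (fun t : ℝ => T - t) (𝓝[<] T) (𝓝[>] 0) := by
    refine tendsto_nhdsWithin_iff.2 ⟨?_, ?_⟩
    · have hc : Continuous (fun t : ℝ => T - t) := by fun_prop
      have := hc.tendsto T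
      simp only [sub_self] at this
      exact this.mono_left nhdsWithin_le_nhds
    · filter_upwards [self_mem_nhdsWithin] with t ht
      exact sub_pos.2 (mem_Iio.1 ht)
  have h2 : Tendsto (fun t : ℝ => slowLog (T - t)) (𝓝[<] T) atTop := tendsto_slowLog.comp h1
  -- the correction term is bounded by `2`
  have h3 : Tendsto (fun t : ℝ => slowLog (T - t) - 2 / (Real.exp 1 * (T - t) + 1)) (𝓝[<] T) atTop := by
    refine tendsto_atTop_add_right_of_le' _ (-2) h2 ?_
    filter_upwards [self_mem_nhdsWithin] with t ht
    have hs : 0 < T - t := sub_pos.2 (mem_Iio.1 ht)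
    have hpos : 1 ≤ Real.exp 1 * (T - t) + 1 := by nlinarith [Real.exp_pos 1]
    have : 2 / (Real.exp 1 * (T - t) + 1) ≤ 2 := by
      rw [div_le_iff₀ (by linarith)]; nlinarith
    linarith
  refine h3.congr' ?_
  filter_upwards [self_mem_nhdsWithin] with t ht
  exact (sqrt_mul_logAmp (mem_Iio.1 ht)).symm

/-- The amplitude is smooth before `T`. [folklore] -/
theorem contDiffOn_logAmp (T : ℝ) {n : WithTop ℕ∞} : ContDiffOn ℝ n (logAmp T) (Iio T) := by
  intro t ht
  have ht' : t < T := ht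
  have hs : 0 < T - t := sub_pos.2 ht'
  have hsq : 0 < Real.sqrt (T - t) := Real.sqrt_pos.2 hs
  have hE : 0 < Real.exp 1 + (T - t)⁻¹ := by linarith [one_lt_exp_add_inv hs]
  have hsub : ContDiffAt ℝ n (fun r : ℝ => T - r) t := contDiffAt_const.sub contDiffAt_id
  have hsqrt : ContDiffAt ℝ n (fun r : ℝ => Real.sqrt (T - r)) t := hsub.sqrt hs.ne'
  have hL : ContDiffAt ℝ n (fun r : ℝ => slowLog (T - r)) t := by
    unfold slowLog
    exact (contDiffAt_const.add (hsub.inv hs.ne')).log hE.ne'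
  have hden : ContDiffAt ℝ n (fun r : ℝ => Real.sqrt (T - r) * (Real.exp 1 * (T - r) + 1)) t :=
    hsqrt.mul ((contDiffAt_const.mul hsub).add contDiffAt_const)
  have hden0 : Real.sqrt (T - t) * (Real.exp 1 * (T - t) + 1) ≠ 0 := by positivity
  exact ((hL.div hsqrt hsq.ne').sub (contDiffAt_const.div hden hden0)).contDiffWithinAt

/-- The log-super drift is a classical Navier–Stokes solution on `[0, T)` (every viscosity). -/
theorem isClassicalNSSolutionOn_logSuper (μ : ℝ) (T : ℝ) (e : ℝ³) :
    IsClassicalNSSolutionOn (Ico 0 T) μ 0 (uniformVel (logAmp T) e)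
      (uniformPres (derivWithin (logAmp T) (Ico 0 T)) e) :=
  isClassicalNSSolutionOn_uniform (uniqueDiffOn_Ico 0 T)
    ((contDiffOn_logAmp T).mono Ico_subset_Iio_self) μ e

/-- **The dyadic displacement of the log-super member is not parabolic**: for every `M` there is
`t ∈ (t₀, T)` with `M ≤ (D(t) - D((t+T)/2))² ‖e‖² / (T - t)` (`e ≠ 0`). [folklore] -/
theorem logDisp_dyadic_unbounded (he : e ≠ 0) {t₀ : ℝ} (ht₀ : t₀ < T) (M : ℝ) :
    ∃ t ∈ Ioo t₀ T, M ≤ (logDisp T t - logDisp T ((t + T) / 2)) ^ 2 * ‖e‖ ^ 2 / (T - t) := by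
  have he2 : 0 < ‖e‖ ^ 2 := pow_pos (norm_pos_iff.2 he) 2
  -- choose `s` small with `L(s)` large
  have hev : ∀ᶠ s in 𝓝[>] (0 : ℝ), 6 ≤ slowLog s ∧ 16 * |M| / ‖e‖ ^ 2 ≤ slowLog s ^ 2 ∧ s < T - t₀ := by
    have h1 := tendsto_slowLog.eventually (eventually_ge_atTop (6 : ℝ))
    have h2 := (tendsto_slowLog.eventually (eventually_ge_atTop (max 1 (16 * |M| / ‖e‖ ^ 2))))
    have h3 : ∀ᶠ s in 𝓝[>] (0 : ℝ), s < T - t₀ := by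
      have : Iio (T - t₀) ∈ 𝓝 (0 : ℝ) := Iio_mem_nhds (sub_pos.2 ht₀)
      exact mem_nhdsWithin_of_mem_nhds this
    filter_upwards [h1, h2, h3] with s hs1 hs2 hs3
    refine ⟨hs1, ?_, hs3⟩
    have hL1 : 1 ≤ slowLog s := (le_max_left _ _).trans hs2
    calc 16 * |M| / ‖e‖ ^ 2 ≤ slowLog s := (le_max_right _ _).trans hs2
      _ ≤ slowLog s ^ 2 := by nlinarith
  obtain ⟨s, ⟨hL6, hLM, hsT⟩, hs⟩ := (hev.and self_mem_nhdsWithin).exists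
  have hs0 : 0 < s := hs
  refine ⟨T - s, ⟨by linarith, by linarith⟩, ?_⟩
  have e1 : T - (T - s) = s := by ring
  have e2 : T - (T - s + T) / 2 = s / 2 := by ring
  have hsq : 0 < Real.sqrt s := Real.sqrt_pos.2 hs0
  -- lower bound for the dyadic displacement
  have hdiff : Real.sqrt s * (slowLog s / 4) ≤ logDisp T (T - s) - logDisp T ((T - s + T) / 2) := by
    simp only [logDisp, e1, e2]
    rw [Real.sqrt_div hs0.le 2]
    have hs2 : (4 : ℝ) / 3 ≤ Real.sqrt 2 := by
      rw [Real.le_sqrt (by norm_num) (by norm_num)]; norm_num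
    have hs2pos : 0 < Real.sqrt 2 := by positivity
    have hhalf := slowLog_half_le hs0
    have hlog2 : Real.log 2 ≤ 1 := by
      have := Real.log_two_lt_d9; linarith
    have hLh0 : 0 ≤ slowLog (s / 2) := (slowLog_pos (half_pos hs0)).le
    -- `2 (√s/√2) L(s/2) ≤ (3/2) √s (L(s) + 1)`
    have hA : 2 * (Real.sqrt s / Real.sqrt 2) * slowLog (s / 2) ≤
        (3 / 2) * Real.sqrt s * (slowLog s + 1) := by
      have h1 : Real.sqrt s / Real.sqrt 2 ≤ (3 / 4) * Real.sqrt s := by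
        rw [div_le_iff₀ hs2pos]; nlinarith
      calc 2 * (Real.sqrt s / Real.sqrt 2) * slowLog (s / 2)
          ≤ 2 * ((3 / 4) * Real.sqrt s) * slowLog (s / 2) := by
            gcongr
        _ ≤ 2 * ((3 / 4) * Real.sqrt s) * (slowLog s + 1) := by
            gcongr; linarith
        _ = (3 / 2) * Real.sqrt s * (slowLog s + 1) := by ring
    nlinarith [hA, hsq, hL6]
  have hdiff0 : 0 ≤ Real.sqrt s * (slowLog s / 4) := by positivity
  have hsqr : (Real.sqrt s * (slowLog s / 4)) ^ 2 = s * (slowLog s ^ 2 / 16) := by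
    rw [mul_pow, Real.sq_sqrt hs0.le]; ring
  rw [e1, le_div_iff₀ hs0]
  have h1 : (Real.sqrt s * (slowLog s / 4)) ^ 2 * ‖e‖ ^ 2 ≤
      (logDisp T (T - s) - logDisp T ((T - s + T) / 2)) ^ 2 * ‖e‖ ^ 2 :=
    mul_le_mul_of_nonneg_right (pow_le_pow_left₀ hdiff0 hdiff 2) he2.le
  rw [hsqr] at h1
  have h2 : M * s ≤ s * (slowLog s ^ 2 / 16) * ‖e‖ ^ 2 := by
    have h3 : |M| ≤ slowLog s ^ 2 / 16 * ‖e‖ ^ 2 := by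
      rw [div_le_iff₀ he2] at hLM; linarith
    have h4 : M ≤ slowLog s ^ 2 / 16 * ‖e‖ ^ 2 := (le_abs_self M).trans h3
    nlinarith
  linarith

/-- **The log-super-Type-I uniform drift admits NO Gaussian-comparable adapted kernel** on any
window `[t₀, T)`, at any pole (`e ≠ 0`): the rate in the linear transfer target is sharp up to a
logarithm. [folklore] -/
theorem logSuper_no_comparable_adapted (hν : 0 < ν) (he : e ≠ 0) {t₀ : ℝ} (ht₀ : t₀ < T) (x₀ : ℝ³) :
    ¬ ∃ G : ℝ → ℝ³ → ℝ, IsAdaptedBackwardKernel ν (uniformVel (logAmp T) e) (Ico t₀ T) T x₀ G ∧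
        IsGaussianComparable G (Ico t₀ T) T x₀ :=
  uniform_no_comparable_of_unbounded_disp hν x₀ (fun _ ht => hasDerivAt_logDisp ht.2)
    (logDisp_dyadic_unbounded he ht₀)

end LogSuper


end Summit.NavierStokesRegularity.NavierStokesRegularity.Theorems.AdaptedKernelExistsNegative.Comoving

end
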